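import Literature.NumberTheory.EllipticCurves.ThreeTorsionDescentCodomain
import Literature.NumberTheory.NumberFields.EisensteinFieldSelmerNormCube
import HarnessLib

/-!
# The `Ê`-side `3`-descent box of the carrier `y² − 21xy + 6137y = x³`: over `ℚ(ζ₃)` the descent classes
# of the RATIONAL points of `E/⟨T⟩` lie in `{[1], [ζ], [ζ²]}`, and `[ζ]` is attained (Cohen–Pazuki, `D̂ = −3`)

[topic NumberTheory/EllipticCurves]

For the cross-prime carrier `E : y² − 21xy + 6137y = x³ = threeTorsionModel (−21/2) (6137/2)` of route
ShaPrimaryTransfer, Vélu's quotient is `E' = threeIsogenyCodomain (−21/2) (6137/2) :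
y² = x³ + (441/4)x² + (1159893/2)x − 789555735/4`, and Cohen–Pazuki's descent map of the dual isogeny is
`α̂(x, y) = y − √−3·(−(21/2)x + 16353/2)` (`ThreeTorsionDescentCodomain`: `(27s + 8m³)/9 = 16353/2`,
`b̂ = 9720`, `4m²/3 = 147`), with values in `K*/K*³`, `K = ℚ(ζ₃) = K3` ([CohenPazuki2009] Def. 1.3 with
`D̂ = −3`: values in «the subgroup `G₃` of classes … whose norm is a cube»).

* **`codescentClass_rat_mem_zeta_pow`** — for every RATIONAL point `(x, y)` of `E'`, the class of
  `α̂(x, y)` in `K3ˣ/K3ˣ³` is `[ζ^i]`, `i < 3`: its norm is the cube `(x + 147)³` (`codescent_mul_conj`),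
  and `3 ∣ ord_v` at every `v ∌ 30` (`three_dvd_log_codescent`: `2b̂√−3 = 19440√−3`, `19440 = 2⁴3⁵5`), so
  `K3.exists_cubeClass_eq_zeta_pow_of_norm_cube` applies — the `Ê`-side Selmer box has dimension `≤ 1`.
* **`codescentClass_P'`** — the rational point `P' = (366, 17739/2)` of `E'` has
  `α̂(P') = 4536 − 8667ζ = ζ·(3 − 21ζ)³`, class `[ζ]`: the box `⟨[ζ]⟩` IS attained, so the `Ê`-side of the
  `3`-isogeny descent of the carrier is SHARP as well (with `Curve6137ThreeDescentBox`: `|Im α| = 9`,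
  `|Im α̂| ≥ 3`, whence Cohen–Pazuki Prop. 2.2 `|Im α|·|Im α̂| = 3^{r+1}` is consistent with `r = 2` exactly).

No named facts; everything proved. The passage «both boxes filled by rational points ⇒ `Ш(E)[3] = 0` ⇒
`t_3(E) = 0`» (the cohomological half of the door at `3`) is the sequel.

## References

* [CohenPazuki2009] H. Cohen, F. Pazuki, Acta Arith. 140 (2009): Definition 1.3, Theorem 2.1, Proposition 2.2.
* Tree: `ThreeTorsionDescentCodomain`, `EisensteinFieldSelmerNormCube`, `EisensteinField`,
  `Curve6137ThreeDescentBox`, `Curve6137TwoIsogenyDescent`.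
-/

noncomputable section

open scoped Classical WithZero

namespace Literature.NumberTheory.EllipticCurves

namespace Carrier6137

open _root_.WeierstrassCurve ThreeTorsionDescent
open Literature.NumberTheory.EllipticCurves.MordellDescent (cubeClass cubeClass_mul_pow_three CubeUnits)
open Literature.NumberTheory.NumberFields Literature.NumberTheory.NumberFields.K3
open NumberField IsDedekindDomain

/-! ## 0. The quotient curve over `K3 = ℚ(ζ₃)` -/

/-- `E'_{K3} = threeIsogenyCodomain (−21/2) (6137/2)` over `K3` is an elliptic curve (it is the Vélu partner of
the elliptic `threeTorsionModel (−21/2) (6137/2)`). [cite: CohenPazuki2009, §1 (discriminant of Ê)] -/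
theorem isElliptic_codomain_K3 : (threeIsogenyCodomain (-21 / 2 : K3) (6137 / 2)).IsElliptic := by
  haveI : (threeTorsionModel (-21 / 2 : K3) (6137 / 2)).IsElliptic :=
    (isElliptic_threeTorsionModel_iff _ _).mpr (by norm_num)
  exact isElliptic_threeIsogenyCodomain

/-- A `K3`-solution of the equation of `E'` is a nonsingular point. [folklore] -/
private theorem nonsingular_codomain {x y : K3}
    (h : y ^ 2 = x ^ 3 + (-21 / 2) ^ 2 * x ^ 2 - 18 * (-21 / 2) * (6137 / 2) * x -
      (27 * (6137 / 2) ^ 2 + 16 * (-21 / 2) ^ 3 * (6137 / 2))) :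
    (threeIsogenyCodomain (-21 / 2 : K3) (6137 / 2)).toAffine.Nonsingular x y := by
  haveI := isElliptic_codomain_K3
  refine Affine.equation_iff_nonsingular.mp ?_
  rw [Affine.equation_iff, threeIsogenyCodomain_a₁, threeIsogenyCodomain_a₂, threeIsogenyCodomain_a₃,
    threeIsogenyCodomain_a₄, threeIsogenyCodomain_a₆]
  linear_combination h

/-- `3 ≠ 0` in `K3`. [folklore] -/
private theorem three_ne : (3 : K3) ≠ 0 := by norm_num

/-- `2 ≠ 0` in `K3`. [folklore] -/
private theorem two_ne : (2 : K3) ≠ 0 := by norm_num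

/-- `b̂ = 9720` for `(m, s) = (−21/2, 6137/2)`. [cite: CohenPazuki2009, Definition 1.3 (b̂ = (27b − 4a³)/9)] -/
theorem bHat_carrier : bHat (-21 / 2 : K3) (6137 / 2) = 9720 := by
  rw [bHat]; norm_num

/-- `(27s + 8m³)/9 = 16353/2`. [cite: CohenPazuki2009, Definition 1.3] -/
private theorem const_carrier : ((27 : K3) * (6137 / 2) + 8 * (-21 / 2) ^ 3) / 9 = 16353 / 2 := by norm_num

/-! ## 1. The class of the rational point `P' = (366, 17739/2)` is `[ζ]` -/

/-- `P' = (366, 17739/2)` lies on `E'`. [folklore] -/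
private theorem hP' : (threeIsogenyCodomain (-21 / 2 : K3) (6137 / 2)).toAffine.Nonsingular 366 (17739 / 2) :=
  nonsingular_codomain (by norm_num)

/-- `3 − 21ζ ≠ 0` (its `ζ`-coordinate is `−21`). [folklore] -/
private theorem three_sub_ne_zero : (3 - 21 * zeta : K3) ≠ 0 := by
  have e : (3 - 21 * zeta : K3) = ⟨3, -21⟩ := by
    rw [mk_eq]; simp only [Rat.cast_ofNat, Rat.cast_neg]; ring
  rw [e]
  intro h0
  have := congrArg QuadraticAlgebra.im h0
  simp at this

/-- **`[α̂(P')] = [ζ]`** for the rational point `P' = (366, 17739/2)` of `E'`: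
`α̂(P') = 17739/2 − θ·(−(21/2)·366 + 16353/2) = 17739/2 − (8667/2)θ = 4536 − 8667ζ = ζ·(3 − 21ζ)³` (`θ = 2ζ + 1`). So the
`Ê`-side descent box `⟨[ζ]⟩` is attained by a rational point. [cite: CohenPazuki2009, Definition 1.3 and Proposition 2.2] -/
theorem codescentClass_P' :
    codescentClass (-21 / 2 : K3) (6137 / 2) theta (.some 366 (17739 / 2) hP') = cubeClass zeta := by
  have hval : (17739 / 2 : K3) - theta * (-21 / 2 * 366 + (27 * (6137 / 2) + 8 * (-21 / 2) ^ 3) / 9) =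
      zeta * (3 - 21 * zeta) ^ 3 := by
    rw [const_carrier, theta]
    have hz := zeta_sq
    have hz3 := zeta_pow_three
    linear_combination (9261 * zeta ^ 2 - 13230 * zeta + 4536 : K3) * hz
  have hne : (17739 / 2 : K3) - theta * (-21 / 2 * 366 + (27 * (6137 / 2) + 8 * (-21 / 2) ^ 3) / 9) ≠ 0 := by
    rw [hval]
    have hz : (zeta : K3) ≠ 0 := isPrimitiveRoot_zeta.ne_zero (by norm_num)
    refine mul_ne_zero hz (pow_ne_zero 3 three_sub_ne_zero)
  rw [codescentClass, codescent_some_of_ne three_ne hP' hne, hval,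
    cubeClass_mul_pow_three (isPrimitiveRoot_zeta.ne_zero (by norm_num)) three_sub_ne_zero]

/-! ## 2. The box: rational points have classes in `{[1], [ζ], [ζ²]}` -/

/-- For `v ∌ 30`: `v(n) = 1` for every natural number `n` dividing a power of `30`. [folklore] -/
private theorem valuation_natCast_eq_one {v : HeightOneSpectrum (𝓞 K3)} (hv : (30 : 𝓞 K3) ∉ v.asIdeal)
    {n : ℕ} {k : ℕ} (hn : n ∣ 30 ^ k) : v.valuation K3 (n : K3) = 1 := by
  have hD : (30 : 𝓞 K3) ^ k ∉ v.asIdeal := fun h => hv (v.isPrime.mem_of_pow_mem _ h)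
  have hy : ((n : ℕ) : 𝓞 K3) ∣ (30 : 𝓞 K3) ^ k := by
    have h1 : ((n : ℕ) : 𝓞 K3) ∣ ((30 ^ k : ℕ) : 𝓞 K3) := Nat.cast_dvd_cast hn
    rwa [Nat.cast_pow, Nat.cast_ofNat] at h1
  have h := valuation_coe_eq_one_of_dvd v hD hy
  rwa [show (((n : ℕ) : 𝓞 K3) : K3) = (n : K3) from map_natCast (algebraMap (𝓞 K3) K3) n] at h

/-- For `v ∌ 30`: `v(θ) = 1` (`θ² = −3` and `v(3) = 1`). [folklore] -/
private theorem valuation_theta_eq_one {v : HeightOneSpectrum (𝓞 K3)} (hv : (30 : 𝓞 K3) ∉ v.asIdeal) :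
    v.valuation K3 theta = 1 := by
  have h3 : v.valuation K3 (theta ^ 2) = 1 := by
    rw [theta_sq, Valuation.map_neg, show (3 : K3) = ((3 : ℕ) : K3) by norm_num]
    exact valuation_natCast_eq_one hv (k := 1) (by norm_num)
  rw [map_pow] at h3
  exact (pow_eq_one_iff.mp h3).resolve_right two_ne_zero

/-- The conjugate of `α̂` at a rational point: `star (y − θL) = y + θL` (`star θ = −θ`, `star` fixes `ℚ`).
[folklore] -/
private theorem star_sub_theta_mul (y L : ℚ) :
    star ((y : K3) - theta * (L : K3)) = (y : K3) + theta * (L : K3) := by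
  have h1 : star ((y : K3)) = (y : K3) := conj_ratCast y
  have h2 : star ((L : K3)) = (L : K3) := conj_ratCast L
  have h3 : star theta = -theta := conj_theta
  rw [star_sub, star_mul', h1, h2, h3]
  ring

/-- `θ ≠ 0`. [folklore] -/
private theorem theta_ne_zero : (theta : K3) ≠ 0 := fun h => by
  have := theta_sq; rw [h] at this; norm_num at this

/-- **The `Ê`-side box**: for every point `(x, y)` of `E' = E/⟨T⟩` with RATIONAL coordinates, the class of
`α̂(x, y)` in `K3ˣ/K3ˣ³` is `[ζ^i]` for some `i < 3` — its norm is the cube `(x + 147)³` and it is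
unramified outside `{λ, 2, 5}`. [cite: CohenPazuki2009, Definition 1.3 (G₃) and Theorem 2.1 (2)] -/
theorem codescentClass_rat_mem_zeta_pow {x y : ℚ}
    (h : (threeIsogenyCodomain (-21 / 2 : K3) (6137 / 2)).toAffine.Nonsingular (x : K3) (y : K3)) :
    ∃ i : ℕ, i < 3 ∧
      codescentClass (-21 / 2 : K3) (6137 / 2) theta (.some (x : K3) (y : K3) h) = cubeClass (zeta ^ i) := by
  -- the linear form `L = −(21/2)x + 16353/2`
  set L : ℚ := -21 / 2 * x + 16353 / 2 with hL
  have hLk : -21 / 2 * (x : K3) + 16353 / 2 = (L : K3) := by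
    simp only [hL, Rat.cast_add, Rat.cast_mul, Rat.cast_div, Rat.cast_neg, Rat.cast_ofNat]
  -- the curve equation, over `K3` and over `ℚ`
  have hE : (y : K3) ^ 2 = (x : K3) ^ 3 + (-21 / 2) ^ 2 * (x : K3) ^ 2 - 18 * (-21 / 2) * (6137 / 2) * (x : K3) -
      (27 * (6137 / 2) ^ 2 + 16 * (-21 / 2) ^ 3 * (6137 / 2)) := by
    have := h.left
    rw [Affine.equation_iff, threeIsogenyCodomain_a₁, threeIsogenyCodomain_a₂, threeIsogenyCodomain_a₃,
      threeIsogenyCodomain_a₄, threeIsogenyCodomain_a₆] at this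
    linear_combination this
  -- the value `y − θL` is non-zero at a rational point
  have hne0 : (y : K3) - theta * (L : K3) ≠ 0 := by
    intro h0
    have hst := congrArg star h0
    rw [star_sub_theta_mul, star_zero] at hst
    have hy2 : (2 : K3) * (y : K3) = 0 := by linear_combination h0 + hst
    have hy : (y : K3) = 0 := (mul_eq_zero.mp hy2).resolve_left two_ne
    have hL0 : theta * (L : K3) = 0 := by linear_combination hst - hy
    have hLz : (L : K3) = 0 := (mul_eq_zero.mp hL0).resolve_left theta_ne_zero
    have hxK : (x : K3) = 16353 / 21 := by linear_combination (-2 / 21 : K3) * (hLk.trans hLz)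
    rw [hy, hxK] at hE
    norm_num at hE
  have hne : (y : K3) - theta * (-21 / 2 * (x : K3) + (27 * (6137 / 2) + 8 * (-21 / 2) ^ 3) / 9) ≠ 0 := by
    rw [const_carrier, hLk]; exact hne0
  have hδ : codescent (-21 / 2 : K3) (6137 / 2) theta (.some (x : K3) (y : K3) h) = (y : K3) - theta * (L : K3) := by
    rw [codescent_some_of_ne three_ne h hne, const_carrier, hLk]
  -- the norm is a rational cube
  have hmul : ((y : K3) - theta * (L : K3)) * ((y : K3) + theta * (L : K3)) = ((x : K3) + 147) ^ 3 := by
    have hm := codescent_mul_conj (m := (-21 / 2 : K3)) (s := 6137 / 2) (θ := theta) theta_sq three_ne h.left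
    rw [const_carrier, hLk] at hm
    rw [hm]; norm_num
  have hnorm : QuadraticAlgebra.norm ((y : K3) - theta * (L : K3)) = (x + 147) ^ 3 := by
    have e1 := QuadraticAlgebra.algebraMap_norm_eq_mul_star ((y : K3) - theta * (L : K3))
    rw [eq_ratCast, star_sub_theta_mul, hmul] at e1
    have e2 : (((x + 147) ^ 3 : ℚ) : K3) = ((x : K3) + 147) ^ 3 := by
      rw [Rat.cast_pow, Rat.cast_add, Rat.cast_ofNat]
    exact Rat.cast_injective (e1.trans e2.symm)
  -- valuations off `30`
  have hval : ∀ v : HeightOneSpectrum (𝓞 K3), (30 : 𝓞 K3) ∉ v.asIdeal →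
      (3 : ℤ) ∣ WithZero.log (v.valuation K3 ((y : K3) - theta * (L : K3))) := by
    intro v hv
    rw [← hδ]
    refine three_dvd_log_codescent (v.valuation K3) theta_sq three_ne ?_ ?_ _
    · rw [bHat_carrier, show (2 : K3) * (9720 * theta) = ((19440 : ℕ) : K3) * theta by push_cast; ring,
        map_mul, valuation_natCast_eq_one hv (k := 5) (by norm_num), valuation_theta_eq_one hv, one_mul]
    · rw [show (2 : K3) * (-21 / 2 * theta) = -(((21 : ℕ) : K3) * theta) by push_cast; ring, Valuation.map_neg,
        map_mul, valuation_theta_eq_one hv, mul_one,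
        show ((21 : ℕ) : K3) = algebraMap (𝓞 K3) K3 ((21 : ℕ) : 𝓞 K3) by rw [map_natCast]]
      exact HeightOneSpectrum.valuation_le_one v _
  obtain ⟨i, hi, hcl⟩ := exists_cubeClass_eq_zeta_pow_of_norm_cube hne0 hval ⟨x + 147, hnorm⟩
  exact ⟨i, hi, by rw [codescentClass, hδ, hcl]⟩

end Carrier6137

end Literature.NumberTheory.EllipticCurves
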